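import Summits.HubbardSuperconductivity.HubbardSuperconductivity.Theses.BcsKacWindow
import Summits.HubbardSuperconductivity.HubbardSuperconductivity.Theorems.BcsKacWindowShellMultiplicityBound

/-!
# Line `pair_shell_rung` — uniform multiplicity of the TWO-PARTICLE (pair) shells of the square-lattice
# torus at every pair momentum (forward rung over the proved floor `ShellMultiplicityBound`)

Crux dir: `Cruxes/NoCondensateBelowAndersonLength/` (item `stmt-HubbardSuperconductivity-1320`, route
`BcsKacWindow`). Forward generator G1, seed `g1-HubbardSuperconductivity-1325` =
`Theorems.BcsKacWindow.shellMultiplicityBound_proof` (item `stmt-HubbardSuperconductivity-1325`, proved).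

WHAT THIS LINE IS: a support-ladder RUNG filed under the crux, not a proof plan OF the crux. The skeleton
concludes `PairShellMultiplicityBound` (the rung) BY NAME from three registered stubs; the witness
`pairShellUpTo_zero : PairShellUpTo 0` (§1, no sorry; also published standalone as
`Lines/pair_shell_rung_special.lean`) pins the graded family to the proved floor. No composition
`PairShellMultiplicityBound → NoCondensateBelowAndersonLength` exists or is claimed (line card, `gap_after`).

FLOOR: `∃ M₀ ∀ L ∀ E ≠ 0, #{(a,b) ∈ (ℤ/L)² : cos(2πa/L) + cos(2πb/L) = E} ≤ M₀` (one-particle Fermi shells).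
RUNG (one move — parameter: total pair momentum `Q = (2πq₁/L, 2πq₂/L)` from `Q = 0` to ALL `Q`):
`∃ M₀ ∀ L q₁ q₂ ∀ E ≠ 0`, `cos(πq₁/L) ≠ 0 → cos(πq₂/L) ≠ 0 →`
`#{(a,b) ∈ (ℤ/L)² : cos(2πa/L) + cos(2π(q₁-a)/L) + cos(2πb/L) + cos(2π(q₂-b)/L) = 2E} ≤ M₀`,
i.e. the pair shells `{k : ε(k) + ε(Q-k) = W}` of `ε(k) = -2(cos k₁ + cos k₂)` are uniformly bounded away
from the two degenerate loci (an antinodal component `Qᵢ = π`, where one coordinate drops out; and the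
nested level `W = 0`, `Q₁ = ±Q₂`, which has `≥ 2L-2` points and is excluded by `E ≠ 0` exactly as in the floor).

PLAN (§2–§3). With `ζ = e^{2πi/L}`, `u = ζ^a`, `v = ζ^b`, `wᵢ = ζ^{qᵢ}` the equation is the 8-term identity
`u + u⁻¹ + w₁u⁻¹ + w₁⁻¹u + v + v⁻¹ + w₂v⁻¹ + w₂⁻¹v = 4E`; subtracting it for a reference solution `(a₀,b₀)`
gives a vanishing 16-term sum of roots of unity. Mann's theorem (tree: `exists_block_ratio_pow_primorial_eq_one`,
`P = primorial 16 = 30030`) puts `u` in a vanishing block all of whose ratios are `P`-th roots of unity;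
sorting the block-mate of `u` by TYPE gives the trichotomy `stub_mann16_dichotomy`: `u^P` is a reference
`P`-th power, or `u^{2P} ∈ {1, w₁^P}`, or `(u,v)` lies on one of `4P` torsion cosets `u = θ·s(v)`,
`s(v) ∈ {v^{±1}, (w₂v⁻¹)^{±1}}` — the block `{u, w₁⁻¹u}` alone is impossible because `1 + w₁⁻¹ ≠ 0`
(`cos(πq₁/L) ≠ 0`). NEW w.r.t. the floor's proof: (i) the type-level (not `fin_cases`) organisation of the
16-term Mann analysis; (ii) the TORSION-COSET step `stub_coset_card_le`: on a coset the pair dispersion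
restricts to `αu + ᾱu⁻¹`, and `α = 0` would force `E = 0`, so each coset carries `≤ 2` solutions (the
shadow of Beukers–Smyth's toric Bezout count for torsion points on curves in `𝔾_m²`); (iii) the fibre bound
`stub_fibre_card_le_two` (`cos(2πb/L) + cos(2π(q₂-b)/L) = 2cos(πq₂/L)cos(π(2b-q₂)/L)`). The composition
`PairShellMultiplicityBound_of` (proved below, no sorry) gives `M₀ = 2·12P + 8P = 32·30030 = 960960`
(numerics: the true maximum is 26 for all `L ≤ 60` and sampled `L ≤ 240`, `num/pair_shell*.py`).
-/

set_option linter.dupNamespace false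

namespace Summit.HubbardSuperconductivity.HubbardSuperconductivity.Cruxes.NoCondensateBelowAndersonLength.PairShellRung

open Finset
open Summit.HubbardSuperconductivity.HubbardSuperconductivity.Theses.BcsKacWindow
  (ShellMultiplicityBound)
open Summit.HubbardSuperconductivity.HubbardSuperconductivity.Theorems.BcsKacWindow
  (shellMultiplicityBound_proof card_filter_pow_pow_eq_le)

/-! ## §1 The graded family, the rung, and the floor witness (verbatim `Sketch.lean`) -/

/-- GRADED FAMILY. Pair shells with pair-momentum indices `q₁, q₂ ≤ K` are uniformly bounded:
`∃ M₀ ∀ L ∀ q₁ q₂ ≤ K ∀ E ≠ 0` (non-degenerate `Q`),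
`#{(a,b) ∈ (ℤ/L)² : cos(2πa/L) + cos(2π(q₁-a)/L) + cos(2πb/L) + cos(2π(q₂-b)/L) = 2E} ≤ M₀`.
`K = 0` is the floor `ShellMultiplicityBound`. -/
def PairShellUpTo (K : ℕ) : Prop :=
  ∃ M₀ : ℕ, ∀ (L q₁ q₂ : ℕ) (E : ℝ), q₁ ≤ K → q₂ ≤ K → E ≠ 0 →
    Real.cos (Real.pi * q₁ / L) ≠ 0 → Real.cos (Real.pi * q₂ / L) ≠ 0 →
    (Finset.univ.filter (fun p : Fin L × Fin L =>
      Real.cos (2 * Real.pi * (p.1 : ℕ) / L) + Real.cos (2 * Real.pi * ((q₁ : ℝ) - (p.1 : ℕ)) / L)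
        + (Real.cos (2 * Real.pi * (p.2 : ℕ) / L)
          + Real.cos (2 * Real.pi * ((q₂ : ℝ) - (p.2 : ℕ)) / L)) = 2 * E)).card ≤ M₀

/-- THE RUNG (`rung_decl`). Uniform multiplicity of the two-particle (pair) shells of the
square-lattice torus at EVERY total pair momentum `Q = (2πq₁/L, 2πq₂/L)`:
`∃ M₀ ∀ L q₁ q₂ ∀ E ≠ 0`, if `cos(πq₁/L) ≠ 0` and `cos(πq₂/L) ≠ 0` then
`#{(a,b) ∈ (ℤ/L)² : cos(2πa/L) + cos(2π(q₁-a)/L) + cos(2πb/L) + cos(2π(q₂-b)/L) = 2E} ≤ M₀`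
(equivalently `#{k : ε(k) + ε(Q-k) = -4E} ≤ M₀` for `ε(k) = -2(cos k₁ + cos k₂)`). -/
def PairShellMultiplicityBound : Prop :=
  ∃ M₀ : ℕ, ∀ (L q₁ q₂ : ℕ) (E : ℝ), E ≠ 0 →
    Real.cos (Real.pi * q₁ / L) ≠ 0 → Real.cos (Real.pi * q₂ / L) ≠ 0 →
    (Finset.univ.filter (fun p : Fin L × Fin L =>
      Real.cos (2 * Real.pi * (p.1 : ℕ) / L) + Real.cos (2 * Real.pi * ((q₁ : ℝ) - (p.1 : ℕ)) / L)
        + (Real.cos (2 * Real.pi * (p.2 : ℕ) / L)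
          + Real.cos (2 * Real.pi * ((q₂ : ℝ) - (p.2 : ℕ)) / L)) = 2 * E)).card ≤ M₀

/-- The rung dominates every member of the graded family (one constant for all `K`). -/
theorem pairShellUpTo_of_bound (h : PairShellMultiplicityBound) (K : ℕ) : PairShellUpTo K := by
  obtain ⟨M₀, hM⟩ := h
  exact ⟨M₀, fun L q₁ q₂ E _ _ hE hq₁ hq₂ => hM L q₁ q₂ E hE hq₁ hq₂⟩

/-- The family is monotone in `K`. -/
theorem pairShellUpTo_mono {K K' : ℕ} (hKK' : K ≤ K') (h : PairShellUpTo K') : PairShellUpTo K := by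
  obtain ⟨M₀, hM⟩ := h
  exact ⟨M₀, fun L q₁ q₂ E hq₁ hq₂ => hM L q₁ q₂ E (hq₁.trans hKK') (hq₂.trans hKK')⟩

/-- At `Q = 0` the pair-shell equation is the floor's shell equation. -/
theorem filter_pairShell_zero_eq (L : ℕ) (E : ℝ) :
    (Finset.univ.filter (fun p : Fin L × Fin L =>
      Real.cos (2 * Real.pi * (p.1 : ℕ) / L) + Real.cos (2 * Real.pi * (((0 : ℕ) : ℝ) - (p.1 : ℕ)) / L)
        + (Real.cos (2 * Real.pi * (p.2 : ℕ) / L)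
          + Real.cos (2 * Real.pi * (((0 : ℕ) : ℝ) - (p.2 : ℕ)) / L)) = 2 * E)) =
    Finset.univ.filter (fun p : Fin L × Fin L =>
      Real.cos (2 * Real.pi * (p.1 : ℕ) / L) + Real.cos (2 * Real.pi * (p.2 : ℕ) / L) = E) := by
  apply Finset.filter_congr
  intro p _
  have h1 : Real.cos (2 * Real.pi * (((0 : ℕ) : ℝ) - (p.1 : ℕ)) / L) =
      Real.cos (2 * Real.pi * (p.1 : ℕ) / L) := by
    rw [← Real.cos_neg]
    congr 1
    push_cast
    ring
  have h2 : Real.cos (2 * Real.pi * (((0 : ℕ) : ℝ) - (p.2 : ℕ)) / L) =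
      Real.cos (2 * Real.pi * (p.2 : ℕ) / L) := by
    rw [← Real.cos_neg]
    congr 1
    push_cast
    ring
  rw [h1, h2]
  constructor
  · intro h
    linarith
  · intro h
    linarith

/-- WITNESS (F3 / BC5): the floor member `K = 0` of the family IS the proved floor
`ShellMultiplicityBound` — from the seed theorem `shellMultiplicityBound_proof`. -/
theorem pairShellUpTo_zero : PairShellUpTo 0 := by
  obtain ⟨M₀, hM⟩ := shellMultiplicityBound_proof
  refine ⟨M₀, fun L q₁ q₂ E hq₁ hq₂ hE _ _ => ?_⟩
  obtain rfl : q₁ = 0 := Nat.le_zero.mp hq₁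
  obtain rfl : q₂ = 0 := Nat.le_zero.mp hq₂
  rw [filter_pairShell_zero_eq L E]
  exact hM L E hE

/-- Conversely the floor member gives back the floor (`PairShellUpTo 0 ↔ ShellMultiplicityBound`:
the family is anchored exactly at the seed). -/
theorem shellMultiplicityBound_of_pairShellUpTo_zero (h : PairShellUpTo 0) : ShellMultiplicityBound := by
  obtain ⟨M₀, hM⟩ := h
  refine ⟨M₀, fun L E hE => ?_⟩
  have h1 : Real.cos (Real.pi * ((0 : ℕ) : ℝ) / L) ≠ 0 := by simp
  have := hM L 0 0 E le_rfl le_rfl hE h1 h1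
  rwa [filter_pairShell_zero_eq L E] at this

theorem pairShellUpTo_zero_iff : PairShellUpTo 0 ↔ ShellMultiplicityBound :=
  ⟨shellMultiplicityBound_of_pairShellUpTo_zero, fun _ => pairShellUpTo_zero⟩

/-! ## §2 Vocabulary of the line and the three registered stubs -/

open scoped Classical

/-- `ζ_L = e^{2πi/L}`, the standard primitive `L`-th root of unity. -/
noncomputable def zeta (L : ℕ) : ℂ := Complex.exp (2 * Real.pi * Complex.I / L)

theorem isPrimitiveRoot_zeta {L : ℕ} (hL : 0 < L) : IsPrimitiveRoot (zeta L) L :=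
  Complex.isPrimitiveRoot_exp L hL.ne'

/-- The pair-shell equation for `(a,b) ∈ (ℤ/L)²` at pair-momentum index `(q₁,q₂)` and level `E`. -/
def IsPairSol (L q₁ q₂ : ℕ) (E : ℝ) (a b : ℕ) : Prop :=
  Real.cos (2 * Real.pi * (a : ℝ) / L) + Real.cos (2 * Real.pi * ((q₁ : ℝ) - (a : ℝ)) / L)
    + (Real.cos (2 * Real.pi * (b : ℝ) / L) + Real.cos (2 * Real.pi * ((q₂ : ℝ) - (b : ℝ)) / L))
    = 2 * E

/-- The eight REFERENCE roots of a solution `(a₀,b₀)`: `x₀^{±1}, (w₁x₀⁻¹)^{±1}, y₀^{±1}, (w₂y₀⁻¹)^{±1}`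
(`x₀ = ζ^{a₀}`, `y₀ = ζ^{b₀}`, `wᵢ = ζ^{qᵢ}`). -/
noncomputable def refRoots (ζ : ℂ) (q₁ q₂ a₀ b₀ : ℕ) : Finset ℂ :=
  {ζ ^ a₀, (ζ ^ a₀)⁻¹, ζ ^ q₁ * (ζ ^ a₀)⁻¹, (ζ ^ q₁)⁻¹ * ζ ^ a₀,
    ζ ^ b₀, (ζ ^ b₀)⁻¹, ζ ^ q₂ * (ζ ^ b₀)⁻¹, (ζ ^ q₂)⁻¹ * ζ ^ b₀}

/-- The four `v`-TYPE roots attached to a second coordinate `b`: `v^{±1}, (w₂v⁻¹)^{±1}` (`v = ζ^b`). -/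
noncomputable def vRoots (ζ : ℂ) (q₂ b : ℕ) : Finset ℂ :=
  {ζ ^ b, (ζ ^ b)⁻¹, ζ ^ q₂ * (ζ ^ b)⁻¹, (ζ ^ q₂)⁻¹ * ζ ^ b}

/-- DIRECT first coordinates: `u^P` equals a reference `P`-th power, or `u^{2P} ∈ {1, w₁^P}` (`u = ζ^a`). -/
def IsDirect (ζ : ℂ) (P q₁ q₂ a₀ b₀ a : ℕ) : Prop :=
  (∃ t ∈ refRoots ζ q₁ q₂ a₀ b₀, (ζ ^ a) ^ P = t ^ P) ∨
    (ζ ^ a) ^ (2 * P) = 1 ∨ (ζ ^ a) ^ (2 * P) = (ζ ^ q₁) ^ P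

/-- COSET solutions: `u / s(v)` is a `P`-th root of unity for some `v`-type root `s(v)`. -/
def OnCoset (ζ : ℂ) (P q₂ a b : ℕ) : Prop :=
  ∃ s ∈ vRoots ζ q₂ b, (ζ ^ a / s) ^ P = 1

/-- **STUB 1 (fibre; size S/M).** For non-degenerate `q₂` and any level `c`, at most two `b ∈ ℤ/L`
solve `cos(2πb/L) + cos(2π(q₂-b)/L) = c`: the left side is `2cos(πq₂/L)·cos(π(2b-q₂)/L)`,
`b ↦ π(2b-q₂)/L (mod 2π)` is injective on `Fin L`, and `cos φ = c'` has at most two solutions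
`mod 2π` (`Real.cos_eq_cos_iff`). -/
theorem stub_fibre_card_le_two {L : ℕ} (hL : 0 < L) (q₂ : ℕ)
    (hq₂ : Real.cos (Real.pi * q₂ / L) ≠ 0) (c : ℝ) :
    (Finset.univ.filter (fun b : Fin L =>
      Real.cos (2 * Real.pi * (b : ℕ) / L) + Real.cos (2 * Real.pi * ((q₂ : ℝ) - (b : ℕ)) / L)
        = c)).card ≤ 2 := by
  sorry

/-- **STUB 2 (Mann-16 trichotomy; size L; the load-bearing stub).** Fix a reference solution
`(a₀,b₀)` and any solution `(a,b)` of the pair-shell equation at `(q₁,q₂,E)`, `cos(πq₁/L) ≠ 0`. With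
`ζ = e^{2πi/L}` and `P = 30030 = primorial 16` (the exponent Mann's theorem gives for 16 terms;
`primorial 16 = 30030` by `decide`, cf. `primorial_eight` in the floor's file): EITHER `a` is direct (`(ζ^a)^P = t^P` for one of the eight
reference roots `t`, or `(ζ^a)^{2P} ∈ {1, (ζ^{q₁})^P}`) OR `(a,b)` lies on a torsion coset
(`(ζ^a / s)^P = 1` for a `v`-type root `s ∈ {ζ^{±b}, (ζ^{q₂}ζ^{-b})^{±1}}`).
Proof route: the two 8-term identities give a vanishing signed sum of 16 roots of unity indexed by
`Fin 16`; apply `Theorems.BcsKacWindow.exists_block_ratio_pow_primorial_eq_one` at the index of `u = ζ^a`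
and sort the guaranteed block-mate `j ≠ i` by type (reference / `u⁻¹`, `w₁u⁻¹` / `v`-type); the only
remaining block `{u, w₁⁻¹u}` would give `u(1 + w₁⁻¹) = 0`, i.e. `ζ^{q₁} = -1`, i.e. `cos(πq₁/L) = 0`. -/
theorem stub_mann16_dichotomy {L : ℕ} (hL : 0 < L) (q₁ q₂ : ℕ) (E : ℝ)
    (hq₁ : Real.cos (Real.pi * q₁ / L) ≠ 0) {a₀ b₀ a b : ℕ}
    (h₀ : IsPairSol L q₁ q₂ E a₀ b₀) (h : IsPairSol L q₁ q₂ E a b) :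
    IsDirect (zeta L) 30030 q₁ q₂ a₀ b₀ a ∨ OnCoset (zeta L) 30030 q₂ a b := by
  sorry

/-- **STUB 3 (torsion-coset count; size M).** For `E ≠ 0` the solutions lying on torsion cosets number
at most `8P`: for each of the `4` types `s` and each `P`-th root of unity `θ` the coset `u = θ·s(v)`
determines `v` from `u`, and on it the 8-term sum equals `αu + ᾱu⁻¹` with
`α = 1 + w₁⁻¹ + θ⁻¹(…)`; `α = 0` would make the sum vanish identically, contradicting `= 4E ≠ 0`, so
`Re(αu) = 2E` leaves `≤ 2` values of `u = ζ^a` (`a ↦ ζ^a` injective on `Fin L`), each with one `b`. -/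
theorem stub_coset_card_le {L : ℕ} (hL : 0 < L) (q₁ q₂ : ℕ) {E : ℝ} (hE : E ≠ 0) :
    (Finset.univ.filter (fun p : Fin L × Fin L =>
      IsPairSol L q₁ q₂ E p.1 p.2 ∧ OnCoset (zeta L) 30030 q₂ p.1 p.2)).card
      ≤ 8 * 30030 := by
  sorry

/-! ## §3 The composition (kernel-checked, no `sorry`): stubs 1–3 ⟹ the rung with `M₀ = 32·30030` (`30030 = primorial 16`) -/

theorem card_refRoots_le (ζ : ℂ) (q₁ q₂ a₀ b₀ : ℕ) : (refRoots ζ q₁ q₂ a₀ b₀).card ≤ 8 := by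
  unfold refRoots
  refine (card_insert_le _ _).trans (Nat.succ_le_succ ?_)
  refine (card_insert_le _ _).trans (Nat.succ_le_succ ?_)
  refine (card_insert_le _ _).trans (Nat.succ_le_succ ?_)
  refine (card_insert_le _ _).trans (Nat.succ_le_succ ?_)
  refine (card_insert_le _ _).trans (Nat.succ_le_succ ?_)
  refine (card_insert_le _ _).trans (Nat.succ_le_succ ?_)
  refine (card_insert_le _ _).trans (Nat.succ_le_succ ?_)
  rw [card_singleton]

/-- The direct first coordinates number at most `12P` (`X^m = c` has `≤ m` roots and `a ↦ ζ^a` is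
injective on `Fin L`: `card_filter_pow_pow_eq_le` from the floor's file). -/
theorem card_filter_isDirect_le {L : ℕ} (hL : 0 < L) (q₁ q₂ a₀ b₀ : ℕ) :
    (Finset.univ.filter (fun a : Fin L =>
      IsDirect (zeta L) 30030 q₁ q₂ a₀ b₀ a)).card ≤ 12 * 30030 := by
  have hζ := isPrimitiveRoot_zeta hL
  generalize zeta L = ζ at hζ ⊢
  have hP : 0 < 30030 := by norm_num
  have h2P : 0 < 2 * 30030 := by norm_num
  have hT : (refRoots ζ q₁ q₂ a₀ b₀).card ≤ 8 := card_refRoots_le ζ q₁ q₂ a₀ b₀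
  have hsub : Finset.univ.filter (fun a : Fin L => IsDirect ζ (30030) q₁ q₂ a₀ b₀ a) ⊆
      (refRoots ζ q₁ q₂ a₀ b₀).biUnion
          (fun t => univ.filter (fun c : Fin L => (ζ ^ (c : ℕ)) ^ 30030 = t ^ 30030)) ∪
        (univ.filter (fun c : Fin L => (ζ ^ (c : ℕ)) ^ (2 * 30030) = 1) ∪
          univ.filter (fun c : Fin L => (ζ ^ (c : ℕ)) ^ (2 * 30030) = (ζ ^ q₁) ^ 30030)) := by
    intro c hc
    rw [mem_filter] at hc
    rw [mem_union, mem_union, mem_biUnion, mem_filter, mem_filter]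
    rcases hc.2 with ⟨t, ht, h⟩ | h | h
    · exact Or.inl ⟨t, ht, mem_filter.mpr ⟨mem_univ _, h⟩⟩
    · exact Or.inr (Or.inl ⟨mem_univ _, h⟩)
    · exact Or.inr (Or.inr ⟨mem_univ _, h⟩)
  calc _ ≤ _ := card_le_card hsub
    _ ≤ ((refRoots ζ q₁ q₂ a₀ b₀).biUnion
          (fun t => univ.filter (fun c : Fin L => (ζ ^ (c : ℕ)) ^ 30030 = t ^ 30030))).card +
        ((univ.filter (fun c : Fin L => (ζ ^ (c : ℕ)) ^ (2 * 30030) = 1)).card +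
          (univ.filter (fun c : Fin L =>
            (ζ ^ (c : ℕ)) ^ (2 * 30030) = (ζ ^ q₁) ^ 30030)).card) :=
          (card_union_le _ _).trans (Nat.add_le_add_left (card_union_le _ _) _)
    _ ≤ (∑ t ∈ refRoots ζ q₁ q₂ a₀ b₀,
          (univ.filter (fun c : Fin L => (ζ ^ (c : ℕ)) ^ 30030 = t ^ 30030)).card) +
        (2 * 30030 + 2 * 30030) :=
          Nat.add_le_add card_biUnion_le
            (Nat.add_le_add (card_filter_pow_pow_eq_le hζ h2P _) (card_filter_pow_pow_eq_le hζ h2P _))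
    _ ≤ (∑ _t ∈ refRoots ζ q₁ q₂ a₀ b₀, 30030) + (2 * 30030 + 2 * 30030) :=
          Nat.add_le_add_right (sum_le_sum fun t _ => card_filter_pow_pow_eq_le hζ hP _) _
    _ ≤ 8 * 30030 + (2 * 30030 + 2 * 30030) := by
          rw [sum_const, smul_eq_mul]
          exact Nat.add_le_add_right (Nat.mul_le_mul_right _ hT) _
    _ = 12 * 30030 := by ring

/-- **The pair-shell count from the stubs.** For `0 < L`, `E ≠ 0`, non-degenerate `(q₁,q₂)` and any
set `F` of solutions, `|F| ≤ 2·12P + 8P`. -/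
theorem card_pairShell_le
    (h₁ : ∀ {L : ℕ}, 0 < L → ∀ (q₂ : ℕ), Real.cos (Real.pi * q₂ / L) ≠ 0 → ∀ c : ℝ,
      (Finset.univ.filter (fun b : Fin L =>
        Real.cos (2 * Real.pi * (b : ℕ) / L) + Real.cos (2 * Real.pi * ((q₂ : ℝ) - (b : ℕ)) / L)
          = c)).card ≤ 2)
    (h₂ : ∀ {L : ℕ}, 0 < L → ∀ (q₁ q₂ : ℕ) (E : ℝ), Real.cos (Real.pi * q₁ / L) ≠ 0 →
      ∀ {a₀ b₀ a b : ℕ}, IsPairSol L q₁ q₂ E a₀ b₀ → IsPairSol L q₁ q₂ E a b →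
        IsDirect (zeta L) 30030 q₁ q₂ a₀ b₀ a ∨ OnCoset (zeta L) 30030 q₂ a b)
    (h₃ : ∀ {L : ℕ}, 0 < L → ∀ (q₁ q₂ : ℕ) {E : ℝ}, E ≠ 0 →
      (Finset.univ.filter (fun p : Fin L × Fin L =>
        IsPairSol L q₁ q₂ E p.1 p.2 ∧ OnCoset (zeta L) 30030 q₂ p.1 p.2)).card
        ≤ 8 * 30030)
    {L : ℕ} (hL : 0 < L) (q₁ q₂ : ℕ) {E : ℝ} (hE : E ≠ 0)
    (hq₁ : Real.cos (Real.pi * q₁ / L) ≠ 0) (hq₂ : Real.cos (Real.pi * q₂ / L) ≠ 0)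
    (F : Finset (Fin L × Fin L)) (hF : ∀ p ∈ F, IsPairSol L q₁ q₂ E p.1 p.2) :
    F.card ≤ 2 * (12 * 30030) + 8 * 30030 := by
  rcases F.eq_empty_or_nonempty with hF0 | hne
  · simp [hF0]
  obtain ⟨p₀, hp₀⟩ := hne
  have h₀ : IsPairSol L q₁ q₂ E p₀.1 p₀.2 := hF p₀ hp₀
  -- the fibre over a first coordinate has at most two points (stub 1)
  have hfib : ∀ a : Fin L,
      (Finset.univ.filter (fun b : Fin L => IsPairSol L q₁ q₂ E a b)).card ≤ 2 := by
    intro a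
    have key := h₁ hL q₂ hq₂
      (2 * E - (Real.cos (2 * Real.pi * ((a : ℕ) : ℝ) / L)
        + Real.cos (2 * Real.pi * ((q₁ : ℝ) - ((a : ℕ) : ℝ)) / L)))
    refine le_trans (card_le_card ?_) key
    intro b hb
    rw [mem_filter] at hb ⊢
    refine ⟨mem_univ _, ?_⟩
    have hb2 : IsPairSol L q₁ q₂ E a b := hb.2
    unfold IsPairSol at hb2
    linarith
  -- the trichotomy (stub 2): every solution sits over a direct first coordinate or on a coset
  have hsub : F ⊆
      (Finset.univ.filter (fun a : Fin L =>
          IsDirect (zeta L) 30030 q₁ q₂ p₀.1 p₀.2 a)).biUnion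
        (fun a => (Finset.univ.filter (fun b : Fin L => IsPairSol L q₁ q₂ E a b)).image
          (fun b => (a, b))) ∪
      Finset.univ.filter (fun p : Fin L × Fin L =>
        IsPairSol L q₁ q₂ E p.1 p.2 ∧ OnCoset (zeta L) 30030 q₂ p.1 p.2) := by
    intro p hp
    have hs : IsPairSol L q₁ q₂ E p.1 p.2 := hF p hp
    rw [mem_union]
    rcases h₂ hL q₁ q₂ E hq₁ h₀ hs with hd | hc
    · left
      rw [mem_biUnion]
      refine ⟨p.1, mem_filter.mpr ⟨mem_univ _, hd⟩, ?_⟩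
      rw [mem_image]
      exact ⟨p.2, mem_filter.mpr ⟨mem_univ _, hs⟩, rfl⟩
    · right
      exact mem_filter.mpr ⟨mem_univ _, hs, hc⟩
  have hA := card_filter_isDirect_le hL q₁ q₂ (p₀.1 : ℕ) (p₀.2 : ℕ)
  have hC := h₃ hL q₁ q₂ hE
  calc F.card ≤ _ := card_le_card hsub
    _ ≤ ((Finset.univ.filter (fun a : Fin L =>
            IsDirect (zeta L) 30030 q₁ q₂ p₀.1 p₀.2 a)).biUnion
          (fun a => (Finset.univ.filter (fun b : Fin L => IsPairSol L q₁ q₂ E a b)).image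
            (fun b => (a, b)))).card +
        (Finset.univ.filter (fun p : Fin L × Fin L =>
          IsPairSol L q₁ q₂ E p.1 p.2 ∧ OnCoset (zeta L) 30030 q₂ p.1 p.2)).card :=
        card_union_le _ _
    _ ≤ (∑ a ∈ Finset.univ.filter (fun a : Fin L =>
            IsDirect (zeta L) 30030 q₁ q₂ p₀.1 p₀.2 a),
          ((Finset.univ.filter (fun b : Fin L => IsPairSol L q₁ q₂ E a b)).image
            (fun b => (a, b))).card) +
        (Finset.univ.filter (fun p : Fin L × Fin L =>
          IsPairSol L q₁ q₂ E p.1 p.2 ∧ OnCoset (zeta L) 30030 q₂ p.1 p.2)).card :=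
        Nat.add_le_add_right card_biUnion_le _
    _ ≤ (∑ _a ∈ Finset.univ.filter (fun a : Fin L =>
            IsDirect (zeta L) 30030 q₁ q₂ p₀.1 p₀.2 a), 2) + 8 * 30030 := by
        refine Nat.add_le_add (sum_le_sum fun a _ => ?_) hC
        exact card_image_le.trans (hfib a)
    _ ≤ 2 * (12 * 30030) + 8 * 30030 := by
        rw [sum_const, smul_eq_mul, Nat.mul_comm]
        exact Nat.add_le_add_right (Nat.mul_le_mul_left _ hA) _

/-- **The rung from the stubs** (`<Rung>_of`, kernel-checked; sorries live only in `stub_*`).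
`M₀ = 2·12P + 8P = 32P` with `P = 30030 = 30030`. -/
theorem PairShellMultiplicityBound_of
    (h₁ : ∀ {L : ℕ}, 0 < L → ∀ (q₂ : ℕ), Real.cos (Real.pi * q₂ / L) ≠ 0 → ∀ c : ℝ,
      (Finset.univ.filter (fun b : Fin L =>
        Real.cos (2 * Real.pi * (b : ℕ) / L) + Real.cos (2 * Real.pi * ((q₂ : ℝ) - (b : ℕ)) / L)
          = c)).card ≤ 2)
    (h₂ : ∀ {L : ℕ}, 0 < L → ∀ (q₁ q₂ : ℕ) (E : ℝ), Real.cos (Real.pi * q₁ / L) ≠ 0 →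
      ∀ {a₀ b₀ a b : ℕ}, IsPairSol L q₁ q₂ E a₀ b₀ → IsPairSol L q₁ q₂ E a b →
        IsDirect (zeta L) 30030 q₁ q₂ a₀ b₀ a ∨ OnCoset (zeta L) 30030 q₂ a b)
    (h₃ : ∀ {L : ℕ}, 0 < L → ∀ (q₁ q₂ : ℕ) {E : ℝ}, E ≠ 0 →
      (Finset.univ.filter (fun p : Fin L × Fin L =>
        IsPairSol L q₁ q₂ E p.1 p.2 ∧ OnCoset (zeta L) 30030 q₂ p.1 p.2)).card
        ≤ 8 * 30030) :
    PairShellMultiplicityBound := by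
  refine ⟨2 * (12 * 30030) + 8 * 30030, fun L q₁ q₂ E hE hq₁ hq₂ => ?_⟩
  rcases Nat.eq_zero_or_pos L with hL0 | hL
  · subst hL0
    exact (card_le_univ _).trans (by simp)
  · exact card_pairShell_le h₁ h₂ h₃ hL q₁ q₂ hE hq₁ hq₂ _ fun p hp => (mem_filter.mp hp).2

/-- The rung, assembled from the three registered stubs (this is what closes when the stubs land). -/
theorem pairShellMultiplicityBound : PairShellMultiplicityBound :=
  PairShellMultiplicityBound_of
    (fun hL q₂ hq₂ c => stub_fibre_card_le_two hL q₂ hq₂ c)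
    (fun hL q₁ q₂ E hq₁ _ _ _ _ h₀ h => stub_mann16_dichotomy hL q₁ q₂ E hq₁ h₀ h)
    (fun hL q₁ q₂ _ hE => stub_coset_card_le hL q₁ q₂ hE)

/-- … and hence every member of the graded family. -/
theorem pairShellUpTo_all (K : ℕ) : PairShellUpTo K :=
  pairShellUpTo_of_bound pairShellMultiplicityBound K

end Summit.HubbardSuperconductivity.HubbardSuperconductivity.Cruxes.NoCondensateBelowAndersonLength.PairShellRung
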